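import Summits.Langlands.Langlands.Theses.NonParallelVoid
import Summits.Langlands.Langlands.Theorems.NonParallelVoidVoidToLanglandsStubAvatarConjugacy
import HarnessLib

/-!
# Disproof of `VoidToLanglands` (crux stmt-Langlands-17006, route NonParallelVoid) — findings

Standing crux-disprover work file (cdisprove cycle 1, refuter-cdisprove-stmt-Langlands-17006-0,
2026-08-17).  Everything below is kernel-checked unless marked; prose lives in docstrings only.

THE CRUX: `VoidToLanglands := Target → Langlands` — the route's declared, not-claimed remainder
(rank 9): `Target` = "non-parallel regular weights are void for `GL₂` over imaginary quadratic
fields" (Calegari–Mazur's parallel-weight prediction), `Langlands` = the audited `∀ 𝓡` summit.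

## Findings (index)

1. REFUTABILITY CRITERION (§1): `¬ VoidToLanglands ↔ Target ∧ ¬ Langlands`
   (`not_voidToLanglands_iff`).  A kill needs BOTH a PROOF of `Target` (open: it is the conjunction
   of the route's five cruxes; Calegari 2010 Thm 1.4 covers only the ordinary / `SL₂(𝔽_p)`-image /
   non-base-change case, Calegari–Mazur Conj. 1.3 and Childers arXiv:2001.04956 §1.5 record the
   rest as open; in-tree the labelled weights are those of Fontaine's `B_dR(F_v)` — the pinned
   datum's period ring IS `bdRPeriodRingData` unconditionally — genuine, hence not computable on
   any explicit irreducible `ρ`) AND a DISPROOF of the summit AS TYPED (none: four statement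
   audits; the only in-tree `¬`-handle, the `ε`-pinned Weil–Deligne half of the Fontaine datum on
   ramified `ρ`, is formally UNDECIDABLE, not false — disprover p105788 on stmt-Langlands-14328).
   Dually `¬ Target → VoidToLanglands` (`voidToLanglands_of_not_target`): the route's own kill
   criterion (an explicit non-parallel geometric `ρ`) would CLOSE this crux trivially, and
   `Langlands → VoidToLanglands` (`voidToLanglands_of_langlands`): the crux is summit-implied, so
   no refutation short of `¬ Langlands` exists.
2. LOAD-BEARING ANALYSIS (§2): the crux has ONE hypothesis, `Target`; dropping it leaves the summit
   verbatim (`VoidToLanglandsWithoutTarget`, `Iff.rfl`).  `voidToLanglands_false_without_Target`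
   would read `¬ Langlands` — not attempted, not believed.  Weakening `Target` (to any consequence
   `T'`) gives `T' → Langlands`, still summit-implied; strengthening it to a false `T''` makes the
   crux trivial.  Nothing refutable on this axis.
3. THE PICKED LINE `satake_sector_cut` (§3–§4; skeleton sha f7dbe3b2…, six open stubs RD / W⁺ / P /
   L∤∀ / B_w⁻ / B_w⁺, U landed p165550): EVERY OPEN STUB IS A CONSEQUENCE OF THE SUMMIT AS TYPED —
   `stubRD_of_langlands`, `stubW_of_langlands`, `stubP_of_langlands`, `stubLA_of_langlands`,
   `stubBoff_of_langlands`, `stubBpar_of_langlands` (P and L∤∀ through the landed change-of-frame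
   package `ReciprocityUpToIrreducibility.corresponds_of_exists_corresponds` /
   `isGeometricFramed_of_isConjugate` / `isConjugate_of_satakeFrobCompatibleAt`: an irreducible
   Satake avatar is conjugate to the summit's `ρ_{π,ι}` and `Corresponds`, `IsGeometricFramed`
   descend to conjugacy classes).  Hence NO stub is refutable short of `¬ Langlands`, none is
   junk-false (every stub carries `0 < n` or `n = 2`; the `n = 0` junk of negatives stmt-Langlands-17212
   cannot enter), and with the landed glue the stub set is EXACTLY summit-strength:
   `Langlands → stubs → VoidToLanglands` (`stubs_of_langlands`, `voidToLanglands_of_stubs`) and,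
   given `Target`, `stubs ↔ Langlands ↔ VoidToLanglands` (`stubs_iff_langlands_of_target`).
   JOINT SUFFICIENCY is the landed `nonParallelVoid_voidToLanglands_of_leaves` (no gap smuggled:
   `Target` is consumed exactly at the sector seam, binder used).
4. WHY IT RESISTS (for the provers): the crux is "Langlands modulo Target"; the disprover has no
   object to attack — no stub of the line is stronger than the summit, and the summit's interfaces
   (`CuspidalAutomorphicRepData`, `ReciprocityData`, the pinned Fontaine datum) admit no junk
   instance this seat could find (Satake parameters are read off genuine Hecke modules; the `∀ 𝓡`
   form is fail-safe through `Nonempty (ReciprocityData F)`; `0 < n` guards `GL₀`).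
5. PRESEARCH (2026-08-17): corpus `lit search "non-parallel weight Galois representation imaginary
   quadratic field geometric"` → [corpus: paper:arxiv-2001.04956 pp. 3–4] (Childers: openness, no
   example); `lit vsearch` (semantic, 8 hits: Bump / Hida / Edixhoven–Couveignes / Emerton–Gee
   stacks — none exhibits a non-parallel geometric `ρ`); `lit galaxy search
   "non-parallel weight|nonparallel weight|parallel weight conjecture" --star all` → 3 rows
   (Tilouine et al. volume, Rockwood 2022 Warwick thesis on `p`-adic Bianchi forms, Goren HMF
   book) — no printed counterexample to `Target`, no printed doubt on `GL_n` reciprocity.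
   OpenAlex / S2 rate-limited (429) during the search: search-degraded for the remote cascade only.

Nothing in this file is a refutation; the `Negative/` lane carries the tightness certificate of §3.
-/

set_option linter.dupNamespace false

noncomputable section

open scoped BigOperators Topology Classical Matrix NumberField
open Filter IsDedekindDomain
open Summit.Langlands
open Summit.Langlands.Langlands.Theorems (ReciprocityUpToIrreducibility.isConjugate_of_satakeFrobCompatibleAt
  ReciprocityUpToIrreducibility.isGeometricFramed_of_isConjugate
  ReciprocityUpToIrreducibility.corresponds_of_exists_corresponds)
open Summit.Langlands.Langlands.Theses.NonParallelVoid (Target VoidToLanglands)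

namespace Summit.Langlands.Langlands.Cruxes.VoidToLanglands.Disproof

/-! ## 1. Refutability criterion -/

/-- The crux IS `Target → Langlands`, definitionally (the antecedent is `Target`'s text inlined).
[folklore] -/
theorem voidToLanglands_iff : VoidToLanglands ↔ (Target → _root_.Langlands) :=
  Iff.rfl

/-- **Refutability criterion.**  `VoidToLanglands` is false iff `Target` HOLDS and the summit FAILS:
a kill needs a proof of Calegari–Mazur's parallel-weight statement AND a disproof of `GL_n`
reciprocity as typed. [folklore] -/
theorem not_voidToLanglands_iff : ¬ VoidToLanglands ↔ (Target ∧ ¬ _root_.Langlands) :=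
  show ¬ (Target → _root_.Langlands) ↔ _ from Classical.not_imp

/-- The summit implies the crux (drop the antecedent): `VoidToLanglands` is no stronger than
`Langlands`, so it is irrefutable short of `¬ Langlands`. [folklore] -/
theorem voidToLanglands_of_langlands (h : _root_.Langlands) : VoidToLanglands :=
  fun _ => h

/-- Dually, a REFUTATION of the route's target closes this crux trivially (ex falso): the route's
kill criterion "an explicit non-parallel geometric `ρ` over an imaginary quadratic field" would
make `VoidToLanglands` a theorem. [folklore] -/
theorem voidToLanglands_of_not_target (h : ¬ Target) : VoidToLanglands :=
  fun hT => absurd hT h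

/-- Given `Target`, the crux is EXACTLY the summit. [folklore] -/
theorem voidToLanglands_iff_langlands_of_target (hT : Target) : VoidToLanglands ↔ _root_.Langlands :=
  ⟨fun h => h hT, fun h _ => h⟩

/-- Unconditionally the crux is equivalent to `¬ Target ∨ Langlands`. [folklore] -/
theorem voidToLanglands_iff_not_target_or : VoidToLanglands ↔ (¬ Target ∨ _root_.Langlands) :=
  show (Target → _root_.Langlands) ↔ _ from imp_iff_not_or

/-! ## 2. Load-bearing analysis (the crux has one hypothesis) -/

/-- `VoidToLanglands` with its only hypothesis `Target` DROPPED: the summit verbatim.  The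
load-bearing certificate `voidToLanglands_false_without_Target : ¬ VoidToLanglandsWithoutTarget`
would be `¬ Langlands` — not provable by this seat (and not believed): recorded, not attempted.
[folklore] -/
def VoidToLanglandsWithoutTarget : Prop :=
  _root_.Langlands

/-- … definitionally. [folklore] -/
theorem voidToLanglandsWithoutTarget_iff : VoidToLanglandsWithoutTarget ↔ _root_.Langlands :=
  Iff.rfl

/-- Dropping the hypothesis can only strengthen: `VoidToLanglandsWithoutTarget → VoidToLanglands`.
[folklore] -/
theorem voidToLanglands_of_without (h : VoidToLanglandsWithoutTarget) : VoidToLanglands :=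
  fun _ => h

/-! ## 3. Line `satake_sector_cut`: the stub statements, verbatim, as named propositions

The texts below are copied VERBATIM from the registered skeleton
`Cruxes/VoidToLanglands/Lines/satake_sector_cut.lean` (the `type_of%` bodies of its `_Goal.stub_*`);
RD = stmt-Langlands-17930, W⁺ = stmt-Langlands-17415, P = stmt-Langlands-17534, L∤∀ = the `∀ Rec`
text of stmt-Langlands-17417, U = stmt-Langlands-17844 (landed p165550), B_w⁻ / B_w⁺ = the sector cut
of stmt-Langlands-17414. -/

/-- Stub RD (`stub_canonicalReciprocityData`), verbatim. [folklore] -/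
def StubRD : Prop :=
  ∀ (F : Type) [Field F] [NumberField F], Nonempty (Summit.Langlands.ReciprocityData F)

/-- Stub W⁺ (`stub_satakeAvatarExistence`), verbatim. [folklore] -/
def StubW : Prop :=
  ∀ (K : Type) [Field K] [NumberField K] (n : ℕ) (hcpt : Literature.NumberTheory.Automorphic.isCompact_glFiniteIntegralLevel n K), 0 < n → ∀ (π : Literature.NumberTheory.Automorphic.CuspidalAutomorphicRepData n K hcpt), π.1.IsLAlgebraic → ∀ (ℓ : ℕ) [Fact ℓ.Prime] (ι : PadicAlgCl ℓ ≃+* ℂ), ∃ ρ : Literature.NumberTheory.GaloisRepresentations.FramedGaloisRep K (PadicAlgCl ℓ) n, ρ.toGaloisRep.IsIrreducible ∧ ∀ᶠ v : IsDedekindDomain.HeightOneSpectrum (NumberField.RingOfIntegers K) in cofinite, SatakeFrobCompatibleAt ι π.1 ρ v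

/-- Stub P (`stub_padicMemberCompatibility`), verbatim. [folklore] -/
def StubP : Prop :=
  ∀ (K : Type) [Field K] [NumberField K] (n : ℕ) (hcpt : Literature.NumberTheory.Automorphic.isCompact_glFiniteIntegralLevel n K), 0 < n → ∀ (π : Literature.NumberTheory.Automorphic.CuspidalAutomorphicRepData n K hcpt), π.1.IsLAlgebraic → ∀ (ℓ : ℕ) [Fact ℓ.Prime] (ι : PadicAlgCl ℓ ≃+* ℂ) (ρ : Literature.NumberTheory.GaloisRepresentations.FramedGaloisRep K (PadicAlgCl ℓ) n), ρ.toGaloisRep.IsIrreducible → (∀ᶠ v : IsDedekindDomain.HeightOneSpectrum (NumberField.RingOfIntegers K) in cofinite, SatakeFrobCompatibleAt ι π.1 ρ v) → ∀ (v : IsDedekindDomain.HeightOneSpectrum (NumberField.RingOfIntegers K)) (hv : ((ℓ : ℕ) : NumberField.RingOfIntegers K) ∈ v.asIdeal), (Literature.NumberTheory.PAdicHodge.fontainePstAdicCompletion v ℓ hv).IsDeRhamFramed (ρ.toLocal v) ∧ ∀ (Rec : ReciprocityData K) (ℓ' : ℕ) [Fact ℓ'.Prime] (ι' : PadicAlgCl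 ℓ' ≃+* ℂ) (ρ' : Literature.NumberTheory.GaloisRepresentations.FramedGaloisRep K (PadicAlgCl ℓ') n), ((ℓ' : ℕ) : NumberField.RingOfIntegers K) ∉ v.asIdeal → ρ'.toGaloisRep.IsIrreducible → (∀ᶠ w : IsDedekindDomain.HeightOneSpectrum (NumberField.RingOfIntegers K) in cofinite, SatakeFrobCompatibleAt ι' π.1 ρ' w) → LocalGlobalCompatibleAt Rec ι' π.1 ρ' v → LocalGlobalCompatibleAt Rec ι π.1 ρ v

/-- Stub L∤∀ (`stub_compatibilityAwayFromLAll`), verbatim. [folklore] -/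
def StubLA : Prop :=
  ∀ (K : Type) [Field K] [NumberField K] (Rec : ReciprocityData K) (n : ℕ) (hcpt : Literature.NumberTheory.Automorphic.isCompact_glFiniteIntegralLevel n K), 0 < n → ∀ (π : Literature.NumberTheory.Automorphic.CuspidalAutomorphicRepData n K hcpt), π.1.IsLAlgebraic → ∀ (ℓ : ℕ) [Fact ℓ.Prime] (ι : PadicAlgCl ℓ ≃+* ℂ) (ρ : Literature.NumberTheory.GaloisRepresentations.FramedGaloisRep K (PadicAlgCl ℓ) n), ρ.toGaloisRep.IsIrreducible → ((∀ᶠ v : IsDedekindDomain.HeightOneSpectrum (NumberField.RingOfIntegers K) in cofinite, ρ.IsUnramifiedAt v) ∧ ∀ (v : IsDedekindDomain.HeightOneSpectrum (NumberField.RingOfIntegers K)) (hv : ((ℓ : ℕ) : NumberField.RingOfIntegers K) ∈ v.asIdeal), (Literature.NumberTheory.PAdicHodge.fontainePstAdicCompletion v ℓ hv).IsDeRhamFramed (ρ.toLocal v)) → (∀ᶠ v : IsDedekindDomain.HeightOneSpectrum (NumberField.RingOfIntegers K) in cofinite, SatakeFrobCompatibleAt ι π.1 ρ v) → ∀ v :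 IsDedekindDomain.HeightOneSpectrum (NumberField.RingOfIntegers K), ((ℓ : ℕ) : NumberField.RingOfIntegers K) ∉ v.asIdeal → LocalGlobalCompatibleAt Rec ι π.1 ρ v

/-- Stub U (`stub_avatarConjugacy`), verbatim — LANDED (p165550), recorded for the tightness
statement only. [folklore] -/
def StubU : Prop :=
  ∀ (K : Type) [Field K] [NumberField K] (n : ℕ) (hcpt : Literature.NumberTheory.Automorphic.isCompact_glFiniteIntegralLevel n K) (π : Literature.NumberTheory.Automorphic.CuspidalAutomorphicRepData n K hcpt) (ℓ : ℕ) [Fact ℓ.Prime] (ι : PadicAlgCl ℓ ≃+* ℂ) (ρ₀ ρ : Literature.NumberTheory.GaloisRepresentations.FramedGaloisRep K (PadicAlgCl ℓ) n), ρ₀.toGaloisRep.IsIrreducible → (∀ᶠ v : IsDedekindDomain.HeightOneSpectrum (NumberField.RingOfIntegers K) in cofinite, SatakeFrobCompatibleAt ι π.1 ρ₀ v) → (∀ᶠ v : IsDedekindDomain.HeightOneSpectrum (NumberField.RingOfIntegers K) in cofinite, SatakeFrobCompatibleAt ι π.1 ρ v) → IsConjugate ρ₀ ρ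

/-- Stub B_w⁻ (`stub_weakAutomorphyOffSector`), verbatim. [folklore] -/
def StubBoff : Prop :=
  ∀ (K : Type) [Field K] [NumberField K] (n : ℕ) (hcpt : Literature.NumberTheory.Automorphic.isCompact_glFiniteIntegralLevel n K), 0 < n → ∀ (ℓ : ℕ) [Fact ℓ.Prime] (ι : PadicAlgCl ℓ ≃+* ℂ) (ρ : Literature.NumberTheory.GaloisRepresentations.FramedGaloisRep K (PadicAlgCl ℓ) n), ρ.toGaloisRep.IsIrreducible → ((∀ᶠ v : IsDedekindDomain.HeightOneSpectrum (NumberField.RingOfIntegers K) in cofinite, ρ.IsUnramifiedAt v) ∧ ∀ (v : IsDedekindDomain.HeightOneSpectrum (NumberField.RingOfIntegers K)) (hv : ((ℓ : ℕ) : NumberField.RingOfIntegers K) ∈ v.asIdeal), (Literature.NumberTheory.PAdicHodge.fontainePstAdicCompletion v ℓ hv).IsDeRhamFramed (ρ.toLocal v)) → ¬ (n = 2 ∧ Algebra.IsQuadraticExtension ℚ K ∧ NumberField.IsTotallyComplex K ∧ ∀ (v : IsDedekindDomain.HeightOneSpectrum (NumberField.RingOfIntegers K)) (hv : ((ℓ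 : ℕ) : NumberField.RingOfIntegers K) ∈ v.asIdeal), letI := (Literature.NumberTheory.PAdicHodge.fontainePstAdicCompletion v ℓ hv).algebra; ∀ τ : v.adicCompletion K →ₐ[ℚ_[ℓ]] PadicAlgCl ℓ, ∃ a b : ℤ, a < b ∧ ρ.labelledHodgeTateWeightsAt v (Literature.NumberTheory.PAdicHodge.fontainePstAdicCompletion v ℓ hv).algebra (Literature.NumberTheory.PAdicHodge.fontainePstAdicCompletion v ℓ hv).𝔅 τ.toRingHom = {a, b}) → ∃ π : Literature.NumberTheory.Automorphic.CuspidalAutomorphicRepData n K hcpt, π.1.IsLAlgebraic ∧ ∀ᶠ v : IsDedekindDomain.HeightOneSpectrum (NumberField.RingOfIntegers K) in cofinite, SatakeFrobCompatibleAt ι π.1 ρ v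

/-- Stub B_w⁺ (`stub_weakParallelModularity`, the `Target`-fed stub), verbatim. [folklore] -/
def StubBpar : Prop :=
  ∀ (F : Type) [Field F] [NumberField F] [Algebra.IsQuadraticExtension ℚ F], NumberField.IsTotallyComplex F → ∀ (hcpt : Literature.NumberTheory.Automorphic.isCompact_glFiniteIntegralLevel 2 F) (ℓ : ℕ) [Fact ℓ.Prime] (ι : PadicAlgCl ℓ ≃+* ℂ) (ρ : Literature.NumberTheory.GaloisRepresentations.FramedGaloisRep F (PadicAlgCl ℓ) 2), ρ.toGaloisRep.IsIrreducible → ((∀ᶠ v : IsDedekindDomain.HeightOneSpectrum (NumberField.RingOfIntegers F) in cofinite, ρ.IsUnramifiedAt v) ∧ ∀ (v : IsDedekindDomain.HeightOneSpectrum (NumberField.RingOfIntegers F)) (hv : ((ℓ : ℕ) : NumberField.RingOfIntegers F) ∈ v.asIdeal), (Literature.NumberTheory.PAdicHodge.fontainePstAdicCompletion v ℓ hv).IsDeRhamFramed (ρ.toLocal v)) → (∀ (v : IsDedekindDomain.HeightOneSpectrum (NumberField.RingOfIntegers F)) (hv : ((ℓ : ℕ) : NumberField.RingOfIntegers F) ∈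 v.asIdeal), letI := (Literature.NumberTheory.PAdicHodge.fontainePstAdicCompletion v ℓ hv).algebra; ∀ τ : v.adicCompletion F →ₐ[ℚ_[ℓ]] PadicAlgCl ℓ, ∃ a b : ℤ, a < b ∧ ρ.labelledHodgeTateWeightsAt v (Literature.NumberTheory.PAdicHodge.fontainePstAdicCompletion v ℓ hv).algebra (Literature.NumberTheory.PAdicHodge.fontainePstAdicCompletion v ℓ hv).𝔅 τ.toRingHom = {a, b}) → (∃ g : ℤ, ∀ (v : IsDedekindDomain.HeightOneSpectrum (NumberField.RingOfIntegers F)) (hv : ((ℓ : ℕ) : NumberField.RingOfIntegers F) ∈ v.asIdeal), letI := (Literature.NumberTheory.PAdicHodge.fontainePstAdicCompletion v ℓ hv).algebra; ∀ τ : v.adicCompletion F →ₐ[ℚ_[ℓ]] PadicAlgCl ℓ, ∃ a : ℤ, ρ.labelledHodgeTateWeightsAt v (Literature.NumberTheory.PAdicHodge.fontainePstAdicCompletion v ℓ hv).algebra (Literature.NumberTheory.PAdicHodge.fontainePstAdicCompletion v ℓ hv).𝔅 τ.toRingHom = {a, a + g}) → ∃ π : Literature.NumberTheory.Automorphic.CuspidalAutomorphicRepData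 2 F hcpt, π.1.IsLAlgebraic ∧ ∀ᶠ v : IsDedekindDomain.HeightOneSpectrum (NumberField.RingOfIntegers F) in cofinite, SatakeFrobCompatibleAt ι π.1 ρ v

/-! ## 4. Tightness: every stub of the line is a consequence of the summit as typed

So no stub is refutable short of `¬ Langlands` (the disprover has no target on this line), and no
stub is junk-false. -/

/-- RD is the summit's non-vacuity conjunct. [folklore] -/
theorem stubRD_of_langlands (h : _root_.Langlands) : StubRD :=
  fun F _ _ => (h F).1

/-- W⁺ from direction (A): keep irreducibility and the Satake clause of `Corresponds`.
[cite: BuzzardGeeLMS2014, Conj. 3.2.2] -/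
theorem stubW_of_langlands (h : _root_.Langlands) : StubW := by
  intro K _ _ n hcpt hn π hL ℓ _ ι
  obtain ⟨⟨Rec⟩, hR⟩ := h K
  obtain ⟨ρ, hirr, -, hcorr, -⟩ := (hR Rec n hn hcpt).1 π hL ℓ ι
  exact ⟨ρ, hirr, hcorr.1⟩

/-- **P from the summit** (the one non-projection): an irreducible Satake avatar `ρ` of `(π, ι)` is
conjugate to the summit's `ρ_{π,ι}` (Chebotarev + Brauer–Nesbitt, landed
`isConjugate_of_satakeFrobCompatibleAt`), geometricity and `Corresponds` descend to conjugacy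
classes (landed `isGeometricFramed_of_isConjugate`, `corresponds_of_exists_corresponds`), so `ρ`
is de Rham above `ℓ` for the pinned datum and locally–globally compatible at EVERY place for EVERY
datum — P's conclusion with its prime-switch hypotheses unused. [cite: DeligneSerreASENS1974, Lemme 3.2] -/
theorem stubP_of_langlands (h : _root_.Langlands) : StubP := by
  intro K _ _ n hcpt hn π hL ℓ _ ι ρ hirr hρ v hv
  obtain ⟨⟨Rec₀⟩, hR⟩ := h K
  refine ⟨?_, fun Rec ℓ' _ ι' ρ' _ _ _ _ => ?_⟩
  · obtain ⟨ρ₁, hirr₁, hgeo₁, hc₁, -⟩ := (hR Rec₀ n hn hcpt).1 π hL ℓ ι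
    have hconj : IsConjugate ρ₁ ρ :=
      ReciprocityUpToIrreducibility.isConjugate_of_satakeFrobCompatibleAt π.1 ι hirr₁ hc₁.1 hρ
    exact (ReciprocityUpToIrreducibility.isGeometricFramed_of_isConjugate hgeo₁ hconj).2 v hv
  · obtain ⟨ρ₁, -, -, hc₁, -⟩ := (hR Rec n hn hcpt).1 π hL ℓ ι
    exact (ReciprocityUpToIrreducibility.corresponds_of_exists_corresponds hirr hρ ⟨ρ₁, hc₁⟩).2 v

/-- **L∤∀ from the summit**, by the same weak-to-strong upgrade. [cite: DeligneSerreASENS1974, Lemme 3.2] -/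
theorem stubLA_of_langlands (h : _root_.Langlands) : StubLA := by
  intro K _ _ Rec n hcpt hn π hL ℓ _ ι ρ hirr _ hρ v _
  obtain ⟨-, hR⟩ := h K
  obtain ⟨ρ₁, -, -, hc₁, -⟩ := (hR Rec n hn hcpt).1 π hL ℓ ι
  exact (ReciprocityUpToIrreducibility.corresponds_of_exists_corresponds hirr hρ ⟨ρ₁, hc₁⟩).2 v

/-- U is a THEOREM (landed p165550); a fortiori summit-implied. [cite: DeligneSerreASENS1974, Lemme 3.2] -/
theorem stubU_holds : StubU :=
  Summit.Langlands.Langlands.Theorems.NonParallelVoidSatakeSectorCut.stub_avatarConjugacy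

/-- B_w⁻ from direction (B) (the sector restriction is discarded; `IsGeometricFramed Rec ρ` is the
pinned hypothesis definitionally, `ReciprocityData.pst` ignoring `Rec`).
[cite: FontaineMazurGeometric1995, Conj. 1] -/
theorem stubBoff_of_langlands (h : _root_.Langlands) : StubBoff := by
  intro K _ _ n hcpt hn ℓ _ ι ρ hirr hgeo _
  obtain ⟨⟨Rec⟩, hR⟩ := h K
  obtain ⟨π, hL, hcorr⟩ := (hR Rec n hn hcpt).2 ℓ ι ρ hirr hgeo
  exact ⟨π, hL, hcorr.1⟩

/-- B_w⁺ (the `Target`-fed stub) from direction (B) at `n = 2`; regularity and parallelism are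
discarded. [cite: FontaineMazurGeometric1995, Conj. 1] [cite: CalegariMazur2008, Conj. 1.3] -/
theorem stubBpar_of_langlands (h : _root_.Langlands) : StubBpar := by
  intro F _ _ _ _ hcpt ℓ _ ι ρ hirr hgeo _ _
  obtain ⟨⟨Rec⟩, hR⟩ := h F
  obtain ⟨π, hL, hcorr⟩ := (hR Rec 2 two_pos hcpt).2 ℓ ι ρ hirr hgeo
  exact ⟨π, hL, hcorr.1⟩

/-- **All seven leaves from the summit.** [folklore] -/
theorem stubs_of_langlands (h : _root_.Langlands) :
    StubRD ∧ StubW ∧ StubP ∧ StubLA ∧ StubU ∧ StubBoff ∧ StubBpar :=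
  ⟨stubRD_of_langlands h, stubW_of_langlands h, stubP_of_langlands h, stubLA_of_langlands h,
    stubU_holds, stubBoff_of_langlands h, stubBpar_of_langlands h⟩

/-- **Joint sufficiency** is the landed glue (`nonParallelVoid_voidToLanglands_of_leaves`): the seven
leaves give the crux, `Target` consumed at the sector seam. [cite: BuzzardGeeLMS2014, Conj. 3.2.2] -/
theorem voidToLanglands_of_stubs (hRD : StubRD) (hW : StubW) (hP : StubP) (hA : StubLA) (hU : StubU)
    (hOff : StubBoff) (hPar : StubBpar) : VoidToLanglands :=
  Summit.Langlands.Langlands.Theorems.NonParallelVoidSatakeSectorCut.nonParallelVoid_voidToLanglands_of_leaves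
    hRD hW hP hA hU hOff hPar

/-- **TIGHTNESS OF THE LINE.**  Given `Target`, the stub set, the summit and the crux coincide:
the line loses nothing and smuggles nothing. [folklore] -/
theorem stubs_iff_langlands_of_target (hT : Target) :
    (StubRD ∧ StubW ∧ StubP ∧ StubLA ∧ StubU ∧ StubBoff ∧ StubBpar) ↔ _root_.Langlands :=
  ⟨fun ⟨hRD, hW, hP, hA, hU, hOff, hPar⟩ => voidToLanglands_of_stubs hRD hW hP hA hU hOff hPar hT,
    stubs_of_langlands⟩

/-- … and unconditionally the crux sits between the stub set and the summit:
`Langlands → stubs → VoidToLanglands`. [folklore] -/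
theorem stubs_sandwich :
    (_root_.Langlands → StubRD ∧ StubW ∧ StubP ∧ StubLA ∧ StubU ∧ StubBoff ∧ StubBpar) ∧
      (StubRD ∧ StubW ∧ StubP ∧ StubLA ∧ StubU ∧ StubBoff ∧ StubBpar → VoidToLanglands) :=
  ⟨stubs_of_langlands, fun ⟨hRD, hW, hP, hA, hU, hOff, hPar⟩ =>
    voidToLanglands_of_stubs hRD hW hP hA hU hOff hPar⟩

/-! ## 5. Targets (the lead's stuck stubs) and near-misses

TARGETS: none handed over yet (payload `stuck_stubs = []`, `targets = []`).  By §4 no stub of this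
line can be killed: a `stub_*_false` theorem would be `¬ Langlands`.

NEAR-MISS / NOT ATTEMPTED (candidate hypothesis-mutation lemma for a later cycle, recorded so nobody
re-derives it): IRREDUCIBILITY IS LOAD-BEARING IN B_w⁺ —
`stub_weakParallelModularity_false_without_irreducible`: the reducible `ρ = ε^a ⊕ ε^b` (`a ≠ b`) over
`F = ℚ(i)` is unramified outside `ℓ`, de Rham, with `HT_τ = {−a, −b}` regular AND parallel at every
label — computable for THE pinned datum since its period ring is `bdRPeriodRingData` unconditionally
(`CyclotomicPowersLabelledWeightsBdR`: `HT_τ(ε^m) = {−m}`; a direct-sum lemma `HT_τ(ρ₁ ⊕ ρ₂) =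
HT_τ(ρ₁) + HT_τ(ρ₂)` for `PeriodRingData.labelD` is NOT in the tree and is the first cost) — while no
cuspidal `π` of `GL₂(𝔸_F)` can be Satake–Frobenius compatible with it a.e. (its Satake parameters
would have absolute values `q_v^{a}`, `q_v^{b}` up to a common twist, against the Jacquet–Shalika
bound `q_v^{-1/2} < |α| < q_v^{1/2}` for unitary cuspidal `π` — a named fact on
`CuspidalAutomorphicRepData` still to be located in the tree, the second cost).  Informational value
for provers is low (Eisenstein representations are not cuspidal — known to all), cost high; parked.

The other hypotheses of B_w⁺ (a.e. unramified, de Rham, regular, parallel) cannot be shown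
load-bearing in-tree at all: dropping any of them yields a statement refutable only by exhibiting a
specific `ρ` with NO Satake-compatible cuspidal `π`, and for irreducible `ρ` no such non-automorphy
certificate exists in print or in the tree. -/

end Summit.Langlands.Langlands.Cruxes.VoidToLanglands.Disproof

end
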